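import Literature.Topology.FourManifolds.CollarSpliceFamilies
import Mathlib.Analysis.Calculus.InverseFunctionTheorem.ContDiff
import Mathlib.Analysis.Normed.Module.Connected
import HarnessLib

/-!
# Blends `id + λ(F - id)` of a disc diffeomorphism fixing the sphere are inner collars

Topic `Literature/Topology/FourManifolds`. Let `f` be a `C^∞` self-map of a finite-dimensional
real inner product space `E` of dimension `≥ 2` which restricts to a bijection of the closed unit
ball with `C^∞` inverse `finv` (on the ball), fixes the unit sphere pointwise and preserves the
open ball — the ambient form of a diffeomorphism `F` of the disc `𝔻` inducing the identity on
`∂𝔻` (`Diffeomorph.closedBallRestrict`, Seeley extension). This file proves that **every blend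
`θ_λ = id + λ (f - id)`, `λ ∈ [0, 1]`, is an inner collar of the unit sphere**
(`Literature.Topology.FourManifolds.IsInnerCollar`, `CollarUniquenessBall.lean`) on a shell of
width independent of `λ`, with a `C^∞` left inverse (`exists_isInnerCollar_blend`). With the
parametric uniqueness of collars (`CollarSpliceFamilies.lean`) this is the input for the converse
half of Cerf's Appendice §2, Proposition 1 at `i = 0`
(`CerfAppendixPropositionOneConverse.lean`: the flat model `π₀(𝒦) = 0` implies Cerf's literal
(2), `π₀ Diff(Dⁿ⁺¹; Sⁿ) = 0`): the blends join the identity to `f` through collars, and their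
splices join the identity to the splice of `f` through diffeomorphisms of the disc fixing the
sphere pointwise.

* `injOn_blend`, `exists_hasFDerivAt_blend_equiv` — on the shell of `exists_lower_bound_blend`
  (for the collar `f` itself) every blend is injective with invertible derivative, up to the
  sphere;
* `exists_shell_subset_image_blend` — a thinner shell, of width `ε'` independent of `λ`, lies in
  the image of the shell under every blend (the image of the open shell is open by the inverse
  function theorem and relatively closed in a thin open shell, which is connected in dimension
  `≥ 2`);
* `exists_isInnerCollar_blend` — hence `IsInnerCollar ε' θ_λ θinv_λ` for all `λ ∈ [0, 1]`, the
  left inverse `θinv_λ` (the inverse on the image of the shell) being `C^∞` up to the sphere by the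
  inverse function theorem for the ambient map `θ_λ`.

Everything is proved; no definitions of new notions and no named facts.

## References

* M. W. Hirsch, *Differential Topology*, GTM 33 (1976), Ch. 8, Thm. 1.8 (uniqueness of collars:
  the convex combination of two collars is a path of collars near the boundary). [HirschDT1976]
* J. Cerf, *Sur les difféomorphismes de la sphère de dimension trois (Γ₄ = 0)*, LNM 53 (1968),
  Appendice §2, Proposition 1. [CerfDiffeoSphere1968]
-/

open scoped Topology ContDiff
open Set Function Metric Filter Real
open scoped InnerProductSpace RealInnerProductSpace

noncomputable section

namespace Literature.Topology.FourManifolds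

namespace IsInnerCollar

variable {E : Type*} [NormedAddCommGroup E] [InnerProductSpace ℝ E] {f finv : E → E}

/-! ### The blends of an ambient collar -/

/-- The blends `θ_λ = id + λ(f - id)` fix the unit sphere pointwise. [folklore] -/
theorem blend_eq_self_of_norm_eq_one {ε : ℝ} (h : IsInnerCollar ε f finv) (t : ℝ) {x : E}
    (hx : ‖x‖ = 1) : x + t • (f x - x) = x := by
  rw [h.eq_self x hx, sub_self, smul_zero, add_zero]

/-- A blend with `λ ∈ [0, 1]` is a convex combination of `x` and `f x`; it maps the closed unit
ball into itself (given that `f` does). [folklore] -/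
theorem norm_blend_le_one {t : ℝ} (ht : t ∈ Icc (0 : ℝ) 1) (hf : ∀ x : E, ‖x‖ ≤ 1 → ‖f x‖ ≤ 1)
    {x : E} (hx : ‖x‖ ≤ 1) : ‖x + t • (f x - x)‖ ≤ 1 := by
  have heq : x + t • (f x - x) = (1 - t) • x + t • f x := by module
  rw [heq]
  calc ‖(1 - t) • x + t • f x‖ ≤ ‖(1 - t) • x‖ + ‖t • f x‖ := norm_add_le _ _
    _ = (1 - t) * ‖x‖ + t * ‖f x‖ := by
        rw [norm_smul, norm_smul, Real.norm_of_nonneg (sub_nonneg.2 ht.2), Real.norm_of_nonneg ht.1]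
    _ ≤ (1 - t) * 1 + t * 1 := by
        gcongr
        · linarith [ht.2]
        · exact ht.1
        · exact hf x hx
    _ = 1 := by ring

/-- A blend with `λ ∈ [0, 1]` maps the open unit ball into itself (given that `f` does).
[folklore] -/
theorem norm_blend_lt_one {t : ℝ} (ht : t ∈ Icc (0 : ℝ) 1) (hf : ∀ x : E, ‖x‖ < 1 → ‖f x‖ < 1)
    {x : E} (hx : ‖x‖ < 1) : ‖x + t • (f x - x)‖ < 1 := by
  have heq : x + t • (f x - x) = (1 - t) • x + t • f x := by module
  rw [heq]
  exact mem_ball_zero_iff.1 ((convex_ball (0 : E) 1) (mem_ball_zero_iff.2 hx)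
    (mem_ball_zero_iff.2 (hf x hx)) (sub_nonneg.2 ht.2) ht.1 (sub_add_cancel _ _))

/-- The blends of a globally `C^∞` map are jointly `C^∞` in `(λ, x)`. [folklore] -/
theorem contDiff_blend (hf : ContDiff ℝ ∞ f) :
    ContDiff ℝ ∞ fun q : ℝ × E => q.2 + q.1 • (f q.2 - q.2) :=
  contDiff_snd.add (contDiff_fst.smul ((hf.comp contDiff_snd).sub contDiff_snd))

/-- The derivative of the blend `θ_λ` of a globally differentiable `f`. [folklore] -/
theorem hasFDerivAt_blend' (hf : ContDiff ℝ ∞ f) (t : ℝ) (x : E) :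
    HasFDerivAt (fun y => y + t • (f y - y))
      ((1 - t) • ContinuousLinearMap.id ℝ E + t • fderiv ℝ f x) x := by
  have hd : HasFDerivAt f (fderiv ℝ f x) x := (hf.differentiable (by simp) x).hasFDerivAt
  have := (hasFDerivAt_id x).add ((hd.sub (hasFDerivAt_id x)).const_smul t)
  have heq : (1 - t) • ContinuousLinearMap.id ℝ E + t • fderiv ℝ f x =
      ContinuousLinearMap.id ℝ E + t • (fderiv ℝ f x - ContinuousLinearMap.id ℝ E) := by module
  rw [heq]
  exact this

/-- For a globally differentiable `f` the within-derivative on the shell is the derivative.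
[folklore] -/
theorem fderivWithin_closedShell_eq (hf : ContDiff ℝ ∞ f) {ε : ℝ} {x : E}
    (hx : x ∈ (closedShell ε : Set E)) : fderivWithin ℝ f (closedShell ε) x = fderiv ℝ f x :=
  (hf.differentiable (by simp) x).hasFDerivAt.hasFDerivWithinAt.fderivWithin
    (uniqueDiffOn_closedShell ε x hx)

/-- **The blends are injective on the shell** of `exists_lower_bound_blend`. [folklore] -/
theorem injOn_blend {ε₃ c : ℝ} (hc : 0 < c)
    (hlow : ∀ t ∈ Icc (0 : ℝ) 1, ∀ x ∈ (closedShell ε₃ : Set E), ∀ y ∈ (closedShell ε₃ : Set E),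
      c * ‖x - y‖ ≤ ‖(x + t • (f x - x)) - (y + t • (f y - y))‖)
    {t : ℝ} (ht : t ∈ Icc (0 : ℝ) 1) : InjOn (fun x => x + t • (f x - x)) (closedShell ε₃) := by
  intro x hx y hy hxy
  have h := hlow t ht x hx y hy
  rw [show (x + t • (f x - x)) - (y + t • (f y - y)) = 0 from sub_eq_zero.2 hxy, norm_zero] at h
  have : ‖x - y‖ ≤ 0 := by nlinarith [norm_nonneg (x - y)]
  exact sub_eq_zero.1 (norm_le_zero_iff.1 this)

/-! ### A thin shell inside the image of every blend -/

/-- The open shell `{1 - δ < ‖x‖ < 1}`, `δ ≤ 1`, is preconnected in dimension `≥ 2` (it is the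
image of `(1 - δ, 1) × 𝕊` under `(r, z) ↦ r • z`). [folklore] -/
theorem isPreconnected_openShell (hE : 1 < Module.rank ℝ E) {δ : ℝ} (hδ : δ ≤ 1) :
    IsPreconnected (openShell δ : Set E) := by
  have himage : (fun q : ℝ × E => q.1 • q.2) '' (Ioo (1 - δ) 1 ×ˢ sphere (0 : E) 1) =
      (openShell δ : Set E) := by
    ext x
    constructor
    · rintro ⟨⟨r, z⟩, ⟨hr, hz⟩, rfl⟩
      have hr0 : 0 < r := by linarith [hr.1]
      dsimp only
      rw [mem_openShell_iff, norm_smul, mem_sphere_zero_iff_norm.1 hz, mul_one, Real.norm_eq_abs,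
        abs_of_pos hr0]
      exact hr
    · intro hx
      obtain ⟨h1, h2⟩ := mem_openShell_iff.1 hx
      have hx0 : x ≠ 0 := by
        intro h0
        rw [h0, norm_zero] at h1
        linarith
      refine ⟨(‖x‖, ‖x‖⁻¹ • x), ⟨⟨h1, h2⟩, ?_⟩, ?_⟩
      · rw [mem_sphere_zero_iff_norm, norm_smul, norm_inv, norm_norm,
          inv_mul_cancel₀ (norm_ne_zero_iff.2 hx0)]
      · dsimp only
        rw [smul_inv_smul₀ (norm_ne_zero_iff.2 hx0)]
  rw [← himage]
  exact (isPreconnected_Ioo.prod (isPreconnected_sphere hE 0 1)).image _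
    ((continuous_fst.smul continuous_snd).continuousOn)

variable [FiniteDimensional ℝ E]

/-- **The derivative of a blend is invertible on the shell, up to the sphere.** At interior
points of the shell this is the lower bound `lower_bound_convexCombination`; at sphere points it is
`injective_convexCombination`. [folklore] -/
theorem exists_hasFDerivAt_blend_equiv {ε : ℝ} (h : IsInnerCollar ε f finv) (hf : ContDiff ℝ ∞ f)
    {ε₃ c : ℝ} (hε₃ : ε₃ ≤ ε)
    (hlow : ∀ t ∈ Icc (0 : ℝ) 1, ∀ x ∈ (closedShell ε₃ : Set E), ∀ y ∈ (closedShell ε₃ : Set E),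
      c * ‖x - y‖ ≤ ‖(x + t • (f x - x)) - (y + t • (f y - y))‖)
    (hc : 0 < c) {t : ℝ} (ht : t ∈ Icc (0 : ℝ) 1) {x : E} (hx : x ∈ (closedShell ε₃ : Set E)) :
    ∃ M : E ≃L[ℝ] E, HasFDerivAt (fun y => y + t • (f y - y)) (M : E →L[ℝ] E) x := by
  set A : E →L[ℝ] E := (1 - t) • ContinuousLinearMap.id ℝ E + t • fderiv ℝ f x with hA
  have hinj : Injective A := by
    rcases (mem_closedShell_iff.1 hx).2.lt_or_eq with hlt | heq
    · -- interior point of the shell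
      have hxo : x ∈ (openShell ε₃ : Set E) := mem_openShell_iff.2 ⟨(mem_closedShell_iff.1 hx).1, hlt⟩
      have hxo' : x ∈ (closedShell ε : Set E) := closedShell_mono hε₃ hx
      refine (injective_iff_map_eq_zero _).2 fun w hw => ?_
      have hb := h.lower_bound_convexCombination hε₃ hlow ht hxo w
      rw [fderivWithin_closedShell_eq hf hxo', ← hA, hw, norm_zero] at hb
      have : ‖w‖ ≤ 0 := by nlinarith [norm_nonneg w]
      exact norm_le_zero_iff.1 this
    · -- sphere point
      have := h.injective_convexCombination heq ht
      rwa [fderivWithin_closedShell_eq hf (closedShell_mono hε₃ hx)] at this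
  set M : E ≃L[ℝ] E :=
    (LinearMap.linearEquivOfInjective (A : E →ₗ[ℝ] E) hinj rfl).toContinuousLinearEquiv with hM
  refine ⟨M, ?_⟩
  have hcoe : (M : E →L[ℝ] E) = A := by ext v; rfl
  rw [hcoe]
  exact hasFDerivAt_blend' hf t x

/-- Images of open subsets of the shell under a blend are open (inverse function theorem).
[folklore] -/
theorem isOpen_image_blend {ε : ℝ} (h : IsInnerCollar ε f finv) (hf : ContDiff ℝ ∞ f)
    {ε₃ c : ℝ} (hε₃ : ε₃ ≤ ε)
    (hlow : ∀ t ∈ Icc (0 : ℝ) 1, ∀ x ∈ (closedShell ε₃ : Set E), ∀ y ∈ (closedShell ε₃ : Set E),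
      c * ‖x - y‖ ≤ ‖(x + t • (f x - x)) - (y + t • (f y - y))‖)
    (hc : 0 < c) {t : ℝ} (ht : t ∈ Icc (0 : ℝ) 1) {W : Set E} (hW : IsOpen W)
    (hWs : W ⊆ closedShell ε₃) : IsOpen ((fun x => x + t • (f x - x)) '' W) := by
  refine isOpen_iff_mem_nhds.2 ?_
  rintro _ ⟨x, hxW, rfl⟩
  obtain ⟨M, hM⟩ := h.exists_hasFDerivAt_blend_equiv hf hε₃ hlow hc ht (hWs hxW)
  have hstrict : HasStrictFDerivAt (fun y => y + t • (f y - y)) (M : E →L[ℝ] E) x :=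
    ((contDiff_blend hf).comp (contDiff_const.prodMk contDiff_id)).contDiffAt.hasStrictFDerivAt' hM
      (by simp)
  rw [← hstrict.map_nhds_eq_of_equiv]
  exact image_mem_map (hW.mem_nhds hxW)

omit [FiniteDimensional ℝ E] in
/-- The blends of a continuous family move points near the sphere little, uniformly: for every
`δ > 0` there is `ρ ∈ (0, δ)` with `‖θ_t ((1 - ρ) z) - z‖ < δ` for all `t ∈ [0, 1]` and a given
unit vector `z` (continuity of `f` at `z`, where `f z = z`). [folklore] -/
theorem exists_blend_near_sphere (hf : Continuous f) {z : E} (hz : ‖z‖ = 1) (hfz : f z = z)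
    {δ : ℝ} (hδ : 0 < δ) :
    ∃ ρ : ℝ, 0 < ρ ∧ ρ < δ ∧ ∀ t ∈ Icc (0 : ℝ) 1, ‖((1 - ρ) • z + t • (f ((1 - ρ) • z) - (1 - ρ) • z)) - z‖ < δ := by
  obtain ⟨η, hη, hηf⟩ := Metric.continuous_iff.1 hf z (δ / 2) (by positivity)
  set ρ : ℝ := min (η / 2) (δ / 2) with hρ
  have hρpos : 0 < ρ := by positivity
  refine ⟨ρ, hρpos, (min_le_right _ _).trans_lt (by linarith), fun t ht => ?_⟩
  set x : E := (1 - ρ) • z with hx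
  have hxz : ‖x - z‖ = ρ := by
    rw [hx, sub_smul, one_smul, sub_sub_cancel_left, norm_neg, norm_smul, hz, mul_one,
      Real.norm_of_nonneg hρpos.le]
  have hfx : ‖f x - z‖ < δ / 2 := by
    rw [← dist_eq_norm, ← hfz]
    exact hηf x (by rw [dist_eq_norm, hxz]; exact (min_le_left _ _).trans_lt (by linarith))
  have heq : (x + t • (f x - x)) - z = (1 - t) • (x - z) + t • (f x - z) := by module
  rw [heq]
  calc ‖(1 - t) • (x - z) + t • (f x - z)‖ ≤ ‖(1 - t) • (x - z)‖ + ‖t • (f x - z)‖ := norm_add_le _ _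
    _ = (1 - t) * ρ + t * ‖f x - z‖ := by
        rw [norm_smul, norm_smul, hxz, Real.norm_of_nonneg (sub_nonneg.2 ht.2), Real.norm_of_nonneg ht.1]
    _ ≤ (1 - t) * (δ / 2) + t * (δ / 2) :=
        add_le_add (mul_le_mul_of_nonneg_left (min_le_right _ _) (sub_nonneg.2 ht.2))
          (mul_le_mul_of_nonneg_left hfx.le ht.1)
    _ = δ / 2 := by ring
    _ < δ := by linarith

/-- **A thin shell lies in the image of every blend** (for `f` an ambient inner collar of width
`1` preserving the open ball, `dim E ≥ 2`). There is `ε' ∈ (0, ε₃]` with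
`closedShell ε' ⊆ θ_t(closedShell ε₃)` for all `t ∈ [0, 1]`: the image of the open shell is open
(inverse function theorem) and relatively closed in the open shell of width `ε'` (a limit of
images `θ_t xₖ`, `xₖ → x₀`, stays away from the sphere unless `x₀` is on it, and away from the
image of the inner sphere `{‖x‖ = 1 - ε₃}`, which has norm `≤ 1 - 2ε'`), and that open shell is
connected. [folklore] -/
theorem exists_shell_subset_image_blend (hE : 1 < Module.rank ℝ E) (h : IsInnerCollar 1 f finv)
    (hf : ContDiff ℝ ∞ f) (hf_lt : ∀ x : E, ‖x‖ < 1 → ‖f x‖ < 1)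
    {ε₃ c : ℝ} (hε₃ : 0 < ε₃) (hε₃1 : ε₃ < 1) (hc : 0 < c)
    (hlow : ∀ t ∈ Icc (0 : ℝ) 1, ∀ x ∈ (closedShell ε₃ : Set E), ∀ y ∈ (closedShell ε₃ : Set E),
      c * ‖x - y‖ ≤ ‖(x + t • (f x - x)) - (y + t • (f y - y))‖) :
    ∃ ε' : ℝ, 0 < ε' ∧ ε' ≤ ε₃ ∧ ∀ t ∈ Icc (0 : ℝ) 1,
      (closedShell ε' : Set E) ⊆ (fun x => x + t • (f x - x)) '' closedShell ε₃ := by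
  -- a bound `m < 1` for the blends on the inner sphere `{‖x‖ = 1 - ε₃}`, uniformly in `t`
  set g : ℝ × E → ℝ := fun q => ‖q.2 + q.1 • (f q.2 - q.2)‖ with hg
  have hgc : Continuous g := (contDiff_blend hf).continuous.norm
  set S : Set (ℝ × E) := Icc (0 : ℝ) 1 ×ˢ sphere (0 : E) (1 - ε₃) with hS
  have hSc : IsCompact S := isCompact_Icc.prod (isCompact_sphere _ _)
  have hglt : ∀ q ∈ S, g q < 1 := by
    rintro ⟨t, x⟩ ⟨ht, hx⟩
    have hx1 : ‖x‖ < 1 := by rw [mem_sphere_zero_iff_norm.1 hx]; linarith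
    exact norm_blend_lt_one ht hf_lt hx1
  obtain ⟨m, hm1, hm⟩ : ∃ m : ℝ, m < 1 ∧ ∀ q ∈ S, g q ≤ m := by
    by_cases hSne : S.Nonempty
    · obtain ⟨q₀, hq₀, hmax⟩ := hSc.exists_isMaxOn hSne hgc.continuousOn
      exact ⟨g q₀, hglt q₀ hq₀, fun q hq => hmax hq⟩
    · exact ⟨0, one_pos, fun q hq => absurd ⟨q, hq⟩ hSne⟩
  set ε' : ℝ := min (ε₃ / 2) ((1 - m) / 2) with hε'
  have hε'pos : 0 < ε' := lt_min (by positivity) (by linarith)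
  have hε'le : ε' ≤ ε₃ := (min_le_left _ _).trans (by linarith)
  have hε'1 : ε' ≤ 1 := hε'le.trans hε₃1.le
  have hm' : m < 1 - ε' := by
    have := min_le_right (ε₃ / 2) ((1 - m) / 2)
    linarith
  refine ⟨ε', hε'pos, hε'le, fun t ht => ?_⟩
  set θ : E → E := fun x => x + t • (f x - x) with hθ
  have hθc : Continuous θ := ((contDiff_blend hf).comp (contDiff_const.prodMk contDiff_id)).continuous
  -- the image of the open shell is open
  set u : Set E := θ '' openShell ε₃ with hu
  have huo : IsOpen u := h.isOpen_image_blend hf hε₃1.le hlow hc ht (isOpen_openShell ε₃)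
    openShell_subset_closedShell
  -- the open shell of width `ε'` is preconnected and meets `u`
  have hso : IsPreconnected (openShell ε' : Set E) := isPreconnected_openShell hE hε'1
  have hne : ((openShell ε' : Set E) ∩ u).Nonempty := by
    -- a unit vector
    obtain ⟨w, hw⟩ : ∃ w : E, w ≠ 0 := by
      haveI : Nontrivial E := rank_pos_iff_nontrivial.1 (lt_trans zero_lt_one hE)
      exact exists_ne 0
    set z : E := ‖w‖⁻¹ • w with hz
    have hz1 : ‖z‖ = 1 := by rw [hz, norm_smul, norm_inv, norm_norm, inv_mul_cancel₀ (norm_ne_zero_iff.2 hw)]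
    obtain ⟨ρ, hρ, hρlt, hnear⟩ := exists_blend_near_sphere hf.continuous hz1 (h.eq_self z hz1)
      (lt_min hε'pos hε₃)
    set x : E := (1 - ρ) • z with hx
    have hρ' : ρ < ε' := hρlt.trans_le (min_le_left _ _)
    have hρ3 : ρ < ε₃ := hρlt.trans_le (min_le_right _ _)
    have hxn : ‖x‖ = 1 - ρ := by
      rw [hx, norm_smul, hz1, mul_one, Real.norm_of_nonneg (by linarith)]
    have hxo : x ∈ (openShell ε₃ : Set E) := mem_openShell_iff.2 ⟨by linarith, by linarith⟩
    refine ⟨θ x, mem_openShell_iff.2 ⟨?_, norm_blend_lt_one ht hf_lt (by linarith)⟩, x, hxo, rfl⟩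
    have h1 : ‖θ x - z‖ < min ε' ε₃ := hnear t ht
    have h2 : ‖z‖ - ‖θ x - z‖ ≤ ‖θ x‖ := by
      have := norm_sub_norm_le z (z - θ x)
      rw [sub_sub_cancel, norm_sub_rev] at this
      linarith
    linarith [min_le_left ε' ε₃]
  -- `u` is relatively closed in the open shell of width `ε'`
  have hcl : closure u ∩ (openShell ε' : Set E) ⊆ u := by
    rintro y ⟨hyc, hys⟩
    obtain ⟨w, hwu, hwy⟩ := mem_closure_iff_seq_limit.1 hyc
    choose x hxo hxw using hwu
    obtain ⟨x₀, hx₀, φ, hφ, hlim⟩ :=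
      (isCompact_closedBall (0 : E) 1).tendsto_subseq fun k => openShell_subset_ball (hxo k) |>
        fun hk => ball_subset_closedBall hk
    have hθx₀ : θ x₀ = y := by
      have h1 : Tendsto (fun k => θ (x (φ k))) atTop (𝓝 (θ x₀)) := (hθc.tendsto x₀).comp hlim
      have h2 : Tendsto (fun k => θ (x (φ k))) atTop (𝓝 y) := by
        have : (fun k => θ (x (φ k))) = fun k => w (φ k) := funext fun k => hxw (φ k)
        rw [this]
        exact hwy.comp hφ.tendsto_atTop
      exact tendsto_nhds_unique h1 h2
    obtain ⟨hy1, hy2⟩ := mem_openShell_iff.1 hys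
    -- `1 - ε₃ ≤ ‖x₀‖ ≤ 1`
    have hx₀le : ‖x₀‖ ≤ 1 := mem_closedBall_zero_iff.1 hx₀
    have hx₀ge : 1 - ε₃ ≤ ‖x₀‖ :=
      ge_of_tendsto' hlim.norm fun k => (mem_openShell_iff.1 (hxo (φ k))).1.le
    -- not on the sphere
    have hx₀lt : ‖x₀‖ < 1 := by
      refine lt_of_le_of_ne hx₀le fun h1 => ?_
      have : θ x₀ = x₀ := h.blend_eq_self_of_norm_eq_one t h1
      rw [this] at hθx₀
      rw [← hθx₀, h1] at hy2
      exact lt_irrefl _ hy2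
    -- not on the inner sphere
    have hx₀gt : 1 - ε₃ < ‖x₀‖ := by
      refine lt_of_le_of_ne hx₀ge fun h1 => ?_
      have hmem : (t, x₀) ∈ S := ⟨ht, mem_sphere_zero_iff_norm.2 h1.symm⟩
      have : ‖θ x₀‖ ≤ m := hm (t, x₀) hmem
      rw [hθx₀] at this
      linarith
    exact ⟨x₀, mem_openShell_iff.2 ⟨hx₀gt, hx₀lt⟩, hθx₀⟩
  have hsub : (openShell ε' : Set E) ⊆ u := hso.subset_of_closure_inter_subset huo hne hcl
  -- conclusion
  intro y hy
  rcases (mem_closedShell_iff.1 hy).2.lt_or_eq with hlt | heq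
  · obtain ⟨x, hx, hxy⟩ := hsub (mem_openShell_iff.2 ⟨(mem_closedShell_iff.1 hy).1, hlt⟩)
    exact ⟨x, openShell_subset_closedShell hx, hxy⟩
  · exact ⟨y, Literature.Topology.FourManifolds.mem_closedShell_of_norm_eq_one hε₃ heq,
      h.blend_eq_self_of_norm_eq_one t heq⟩

/-- **Every blend of an ambient disc collar is an inner collar**, on a shell of width independent
of the blend parameter. Let `f` be globally `C^∞`, an inner collar of width `1` with left inverse
`finv` (e.g. the ambient form of a diffeomorphism of the disc inducing the identity on the
sphere), preserving the closed and the open unit ball, `dim E ≥ 2`. Then there are `ε' > 0` and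
left inverses `θinv_t` with `IsInnerCollar ε' (id + t(f - id)) (θinv_t)` for every `t ∈ [0, 1]`.
The left inverse is the inverse on the image of the shell of `exists_lower_bound_blend`
(`Function.invFunOn`); it is `C^∞` up to the sphere because near each point it is the local
inverse of the ambient blend given by the inverse function theorem. Hirsch (1976), Ch. 8,
Thm. 1.8 (convex combinations of collars). [cite: HirschDT1976, Ch. 8 Thm. 1.8] -/
theorem exists_isInnerCollar_blend (hE : 1 < Module.rank ℝ E) (h : IsInnerCollar 1 f finv)
    (hf : ContDiff ℝ ∞ f) (hf_le : ∀ x : E, ‖x‖ ≤ 1 → ‖f x‖ ≤ 1)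
    (hf_lt : ∀ x : E, ‖x‖ < 1 → ‖f x‖ < 1) :
    ∃ ε' : ℝ, 0 < ε' ∧ ∃ θinv : ℝ → E → E, ∀ t ∈ Icc (0 : ℝ) 1,
      IsInnerCollar ε' (fun x => x + t • (f x - x)) (θinv t) := by
  classical
  obtain ⟨ε₃, c, hε₃, hε₃1, hc, hlow⟩ := h.exists_lower_bound_blend
  obtain ⟨ε', hε', hε'le, hsurj⟩ := exists_shell_subset_image_blend hE h hf hf_lt hε₃ hε₃1 hc hlow
  haveI : Nonempty E := ⟨0⟩
  refine ⟨ε', hε', fun t => invFunOn (fun x => x + t • (f x - x)) (closedShell ε₃), fun t ht => ?_⟩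
  set θ : E → E := fun x => x + t • (f x - x) with hθ
  have hθs : ContDiff ℝ ∞ θ := (contDiff_blend hf).comp (contDiff_const.prodMk contDiff_id)
  have hinj : InjOn θ (closedShell ε₃) := injOn_blend hc hlow ht
  have hleft : LeftInvOn (invFunOn θ (closedShell ε₃)) θ (closedShell ε₃) := hinj.leftInvOn_invFunOn
  -- inverse of points of the thin shell
  have hinv : ∀ y ∈ (closedShell ε' : Set E), invFunOn θ (closedShell ε₃) y ∈ (closedShell ε₃ : Set E) ∧
      θ (invFunOn θ (closedShell ε₃) y) = y := fun y hy => invFunOn_pos (hsurj t ht hy)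
  refine ⟨hε', hθs.contDiffOn, ?_, fun x hx => h.blend_eq_self_of_norm_eq_one t hx,
    fun x hx => norm_blend_le_one ht hf_le (mem_closedShell_iff.1 hx).2,
    fun x _ hx => norm_blend_lt_one ht hf_lt hx,
    fun x hx _ => hleft (closedShell_mono hε'le hx)⟩
  -- smoothness of the left inverse on the thin shell, up to the sphere
  intro y₀ hy₀
  obtain ⟨hx₀, hθx₀⟩ := hinv y₀ hy₀
  set x₀ := invFunOn θ (closedShell ε₃) y₀ with hx₀_def
  obtain ⟨M, hM⟩ := h.exists_hasFDerivAt_blend_equiv hf hε₃1.le hlow hc ht hx₀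
  have hθat : ContDiffAt ℝ ∞ θ x₀ := hθs.contDiffAt
  have hstrict := hθat.hasStrictFDerivAt' hM (by simp)
  set g := hθat.localInverse hM (by simp) with hg_def
  have hg : ContDiffAt ℝ ∞ g y₀ := by
    have := hθat.to_localInverse hM (by simp)
    rwa [hθx₀] at this
  have hgleft : ∀ᶠ x in 𝓝 x₀, g (θ x) = x := hstrict.eventually_left_inverse
  obtain ⟨η, hη, hηg⟩ := Metric.eventually_nhds_iff.1 hgleft
  -- on the thin shell near `y₀`, `invFunOn θ` agrees with `g`
  have hagree : ∀ y ∈ (closedShell ε' : Set E), dist y y₀ < c * η → invFunOn θ (closedShell ε₃) y = g y := by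
    intro y hy hyd
    rw [dist_eq_norm] at hyd
    obtain ⟨hx, hθx⟩ := hinv y hy
    have hd : dist (invFunOn θ (closedShell ε₃) y) x₀ < η := by
      rw [dist_eq_norm]
      have hb := hlow t ht _ hx _ hx₀
      rw [show (invFunOn θ (closedShell ε₃) y) + t • (f (invFunOn θ (closedShell ε₃) y) -
        (invFunOn θ (closedShell ε₃) y)) = θ (invFunOn θ (closedShell ε₃) y) from rfl, hθx,
        show x₀ + t • (f x₀ - x₀) = θ x₀ from rfl, hθx₀] at hb
      by_contra hge
      have : c * η ≤ c * ‖invFunOn θ (closedShell ε₃) y - x₀‖ :=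
        mul_le_mul_of_nonneg_left (not_lt.1 hge) hc.le
      linarith
    have := hηg hd
    rw [hθx] at this
    exact this.symm
  have hev : invFunOn θ (closedShell ε₃) =ᶠ[𝓝[closedShell ε'] y₀] g := by
    have : (closedShell ε' : Set E) ∩ ball y₀ (c * η) ∈ 𝓝[closedShell ε'] y₀ :=
      inter_mem_nhdsWithin _ (ball_mem_nhds _ (mul_pos hc hη))
    filter_upwards [this] with y hy
    exact hagree y hy.1 (mem_ball.1 hy.2)
  exact hg.contDiffWithinAt.congr_of_eventuallyEq hev (hagree y₀ hy₀ (by simp [mul_pos hc hη]))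

end IsInnerCollar

end Literature.Topology.FourManifolds
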